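import Summits.Ventures.HodgeRepro2.T5SU11ResolventEigenfunction
import Summits.Ventures.HodgeRepro2.T5SU11ResolventL2SchurWeighted

/-!
# The ground-state weight `Ξ = φ_1`: the sharp weighted sup-norm bound `‖G^I_λ‖ ≤ 1/(λ − 1)²` for every `λ > 1`

Row 4xx (`greenSolI_sph_one_eq`) gives the resolvent of the ground state, `G^I_λ Ξ = −Ξ/(μ + 1) = −Ξ/(λ − 1)²`. Since the
kernel is negative this is the weighted row sum at the EDGE weight `Ξ = φ_1`:

* `integrableOn_abs_sphGreenKernel_mul_sph_one`, `integral_abs_sphGreenKernel_mul_sph_one` —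
  **`∫_{(0,∞)} |K_λ(t, s)| Ξ(s) sinh 2s ds = Ξ(t)/(λ − 1)²`** for every `t > 0`, `λ > 1` (rows 548/550 used the weight
  `φ_{λ′}`, `1 < λ′ < λ`, with the constant `1/(μ − μ′)`; the edge `λ′ = 1` gives the sharp constant `1/(μ + 1)`);
* `abs_greenSolI_le_mul_sph_one` — **`|g| ≤ D Ξ` on `(0, ∞)` ⇒ `|G^I_λ g(t)| ≤ D Ξ(t)/(λ − 1)²`**, for a source of the class;
* `class_of_le_mul_sph_one` — **the weighted space `W_1 = {g continuous on (0, ∞) : |g| ≤ D Ξ}` lies in the class for every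
  `λ > 1`** (`Ξ ≤ 1` and `Ξ(s) ≤ C e^{−εs}` for every `ε < 1`);
* `abs_greenSolI_le_mul_sph_one'`, `greenSolI_mem_weighted_one` — **`G^I_λ` maps `W_1` into itself with
  `‖G^I_λ‖_{W_1} ≤ 1/(λ − 1)²`**, the sharp constant `1/dist(μ, −ρ²)`, with no hypothesis beyond `g ∈ W_1`.

Nothing is claimed about (N).

Blind lane: Mathlib + the HodgeRepro2 prefix only; no sorry; axioms ⊆ {propext, Classical.choice,
Quot.sound}.
-/

namespace Summit.Ventures.HodgeRepro2.T5SU11ResolventGroundStateWeight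

open Filter Topology MeasureTheory
open Set (Ioi Ioc)
open T5SU11Cartan T5SU11SphericalFunction T5SU11SphericalDecay T5SU11RadialGreenKernel
  T5SU11RadialGreenImproper T5SU11RadialGreenImproperDecaySource T5SU11RadialGreenImproperStable
  T5SU11ResolventKernelComposition T5SU11ResolventTransformClass T5SU11RadialGreenPositivity
  T5SU11SphericalContinuous T5SU11SphericalBounds T5SU11ResolventEigenfunction

section measure

variable [MeasurableSpace Circle] [BorelSpace Circle]

variable {lam : ℝ} (hlam : 1 < lam)

include hlam in
/-- **The class data of the ground state `Ξ = φ_1`** for every `λ > 1`: continuous on `(0, ∞)`, bounded on `(0, 1]`, and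
`Ξ(s) ≤ C e^{−εs}` at the rate `ε = (3 − λ)/2 ∈ (2 − λ, 1)`. -/
theorem sph_one_class :
    ContinuousOn (fun s => sph 1 (hyp s)) (Ioi 0) ∧
    (∃ Φ : ℝ, 0 ≤ Φ ∧ ∀ s ∈ Ioc (0 : ℝ) 1, |sph 1 (hyp s)| ≤ Φ) ∧
    (2 - lam < (3 - lam) / 2 ∧ ∃ C : ℝ, ∀ s, (0 : ℝ) ≤ s → |sph 1 (hyp s)| ≤ C * Real.exp (-((3 - lam) / 2) * s)) := by
  refine ⟨(continuous_sph_hyp 1).continuousOn, exists_abs_sph_le_one 1, by linarith, ?_⟩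
  exact exists_abs_sph_one_le_exp (by linarith)

include hlam in
/-- **The weighted rows at the edge are integrable**: `s ↦ |K_λ(t, s)| Ξ(s) sinh 2s` is integrable on `(0, ∞)` (`t > 0`). -/
theorem integrableOn_abs_sphGreenKernel_mul_sph_one {t : ℝ} (ht : 0 < t) :
    IntegrableOn (fun s => |sphGreenKernel lam t s| * sph 1 (hyp s) * Real.sinh (2 * s)) (Ioi 0) := by
  obtain ⟨hg, ⟨Φ, hΦ0, hΦ⟩, hε, C, hC⟩ := sph_one_class hlam
  have hB := integrableOn_sph_mul_mul_sinh_Ioc hg hΦ hΦ0 lam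
  have hA := integrableOn_sphDecay_mul_mul_sinh hlam hg hΦ hΦ0 hε (fun s hs => hC s hs)
  have hI := integrableOn_kernel_mul hB hA ht
  refine hI.neg.congr_fun (fun s _ => ?_) measurableSet_Ioi
  simp only [Pi.neg_apply]
  rw [abs_of_neg (sphGreenKernel_neg hlam ht)]
  unfold sphGreenKernel
  ring

include hlam in
/-- **THE WEIGHTED ROW SUMS AT THE EDGE**: `∫_{(0,∞)} |K_λ(t, s)| Ξ(s) sinh 2s ds = Ξ(t)/(λ − 1)²` for every `t > 0`, `λ > 1`
(`G^I_λ Ξ = −Ξ/(μ + 1)` and `K_λ < 0`). -/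
theorem integral_abs_sphGreenKernel_mul_sph_one {t : ℝ} (ht : 0 < t) :
    ∫ s in Ioi 0, |sphGreenKernel lam t s| * sph 1 (hyp s) * Real.sinh (2 * s) = sph 1 (hyp t) / (lam - 1) ^ 2 := by
  obtain ⟨hg, ⟨Φ, hΦ0, hΦ⟩, hε, C, hC⟩ := sph_one_class hlam
  have hB := integrableOn_sph_mul_mul_sinh_Ioc hg hΦ hΦ0 lam
  have hA := integrableOn_sphDecay_mul_mul_sinh hlam hg hΦ hΦ0 hε (fun s hs => hC s hs)
  have hrep := greenSolI_eq_integral_kernel hB hA ht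
  rw [greenSolI_sph_one_eq hlam ht] at hrep
  have e : (fun s => |sphGreenKernel lam t s| * sph 1 (hyp s) * Real.sinh (2 * s))
      = fun s => -(greenKernel (fun t => sph lam (hyp t)) (sphDecay lam) t s * sph 1 (hyp s) * Real.sinh (2 * s)) := by
    funext s
    rw [abs_of_neg (sphGreenKernel_neg hlam ht)]
    unfold sphGreenKernel
    ring
  have hden : lam * (lam - 2) + 1 = (lam - 1) ^ 2 := by ring
  rw [e, MeasureTheory.integral_neg, ← hrep, hden]
  ring

include hlam in
/-- **THE SHARP WEIGHTED `L^∞` BOUND**: for a source `g` of the class with `|g| ≤ D Ξ` on `(0, ∞)`,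
`|G^I_λ g(t)| ≤ D Ξ(t)/(λ − 1)²` for every `t > 0`. -/
theorem abs_greenSolI_le_mul_sph_one {g : ℝ → ℝ} (hg : ContinuousOn g (Ioi 0))
    {M : ℝ} (hM : ∀ s ∈ Ioc (0 : ℝ) 1, |g s| ≤ M) (hM0 : 0 ≤ M)
    {ε C s₀ : ℝ} (hε : 2 - lam < ε) (hC : ∀ s, s₀ ≤ s → |g s| ≤ C * Real.exp (-ε * s))
    {D : ℝ} (hD : ∀ s, 0 < s → |g s| ≤ D * sph 1 (hyp s)) {t : ℝ} (ht : 0 < t) :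
    |greenSolI (fun t => sph lam (hyp t)) (sphDecay lam) g t| ≤ D * sph 1 (hyp t) / (lam - 1) ^ 2 := by
  have hB := integrableOn_sph_mul_mul_sinh_Ioc hg hM hM0 lam
  have hA := integrableOn_sphDecay_mul_mul_sinh hlam hg hM hM0 hε hC
  have hI1 : IntegrableOn (fun s => |sphGreenKernel lam t s * g s * Real.sinh (2 * s)|) (Ioi 0) :=
    (integrableOn_kernel_mul hB hA ht).abs
  have hI2 : IntegrableOn (fun s => D * (|sphGreenKernel lam t s| * sph 1 (hyp s) * Real.sinh (2 * s))) (Ioi 0) :=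
    (integrableOn_abs_sphGreenKernel_mul_sph_one hlam ht).const_mul D
  rw [greenSolI_eq_integral_kernel hB hA ht]
  change |∫ s in Ioi 0, sphGreenKernel lam t s * g s * Real.sinh (2 * s)| ≤ _
  calc |∫ s in Ioi 0, sphGreenKernel lam t s * g s * Real.sinh (2 * s)|
      ≤ ∫ s in Ioi 0, |sphGreenKernel lam t s * g s * Real.sinh (2 * s)| := by
        have := norm_integral_le_integral_norm (μ := volume.restrict (Ioi 0))
          (fun s => sphGreenKernel lam t s * g s * Real.sinh (2 * s))
        simpa only [Real.norm_eq_abs] using this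
    _ ≤ ∫ s in Ioi 0, D * (|sphGreenKernel lam t s| * sph 1 (hyp s) * Real.sinh (2 * s)) := by
        refine setIntegral_mono_on hI1 hI2 measurableSet_Ioi (fun s hs => ?_)
        have hs0 : 0 < s := hs
        have hsinh : 0 ≤ Real.sinh (2 * s) := Real.sinh_nonneg_iff.mpr (by linarith)
        rw [abs_mul, abs_mul, abs_of_nonneg hsinh]
        calc |sphGreenKernel lam t s| * |g s| * Real.sinh (2 * s)
            ≤ |sphGreenKernel lam t s| * (D * sph 1 (hyp s)) * Real.sinh (2 * s) :=
              mul_le_mul_of_nonneg_right (mul_le_mul_of_nonneg_left (hD s hs0) (abs_nonneg _)) hsinh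
          _ = D * (|sphGreenKernel lam t s| * sph 1 (hyp s) * Real.sinh (2 * s)) := by ring
    _ = D * sph 1 (hyp t) / (lam - 1) ^ 2 := by
        rw [MeasureTheory.integral_const_mul, integral_abs_sphGreenKernel_mul_sph_one hlam ht]
        ring

include hlam in
/-- **The ground-state weighted space lies in the class for every `λ > 1`**: `|g| ≤ D Ξ` on `(0, ∞)` ⇒ `|g| ≤ D` on
`(0, 1]`, `D ≥ 0`, and `|g(s)| ≤ D C e^{−εs}` for `s ≥ 0` at the rate `ε = (3 − λ)/2 > 2 − λ`. -/
theorem class_of_le_mul_sph_one {g : ℝ → ℝ} {D : ℝ} (hD : ∀ s, 0 < s → |g s| ≤ D * sph 1 (hyp s)) :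
    (∀ s ∈ Ioc (0 : ℝ) 1, |g s| ≤ D) ∧ 0 ≤ D ∧ 2 - lam < (3 - lam) / 2 ∧
      ∃ C : ℝ, ∀ s, (1 : ℝ) ≤ s → |g s| ≤ (D * C) * Real.exp (-((3 - lam) / 2) * s) := by
  have hD0 : 0 ≤ D := by
    have h := hD 1 one_pos
    have hφ : 0 < sph 1 (hyp 1) := sph_hyp_pos 1 1
    by_contra hneg
    have : D * sph 1 (hyp 1) < 0 := mul_neg_of_neg_of_pos (not_le.mp hneg) hφ
    linarith [abs_nonneg (g 1)]
  obtain ⟨C, hC⟩ := exists_abs_sph_one_le_exp (ε := (3 - lam) / 2) (by linarith)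
  refine ⟨fun s hs => ?_, hD0, by linarith, C, fun s hs => ?_⟩
  · calc |g s| ≤ D * sph 1 (hyp s) := hD s hs.1
      _ ≤ D * 1 := mul_le_mul_of_nonneg_left (sph_hyp_le_one (by norm_num) (by norm_num) s) hD0
      _ = D := mul_one D
  · have hs0 : 0 < s := by linarith
    calc |g s| ≤ D * sph 1 (hyp s) := hD s hs0
      _ = D * |sph 1 (hyp s)| := by rw [abs_of_pos (sph_hyp_pos 1 s)]
      _ ≤ D * (C * Real.exp (-((3 - lam) / 2) * s)) := mul_le_mul_of_nonneg_left (hC s hs0.le) hD0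
      _ = (D * C) * Real.exp (-((3 - lam) / 2) * s) := by ring

include hlam in
/-- **THE SHARP WEIGHTED `L^∞` BOUND ON `W_1`**: `|G^I_λ g(t)| ≤ D Ξ(t)/(λ − 1)²` for every continuous `g` with `|g| ≤ D Ξ`
on `(0, ∞)` — no other hypothesis, every `λ > 1`. -/
theorem abs_greenSolI_le_mul_sph_one' {g : ℝ → ℝ} (hg : ContinuousOn g (Ioi 0))
    {D : ℝ} (hD : ∀ s, 0 < s → |g s| ≤ D * sph 1 (hyp s)) {t : ℝ} (ht : 0 < t) :
    |greenSolI (fun t => sph lam (hyp t)) (sphDecay lam) g t| ≤ D * sph 1 (hyp t) / (lam - 1) ^ 2 := by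
  obtain ⟨hM, hD0, hε, C, hC⟩ := class_of_le_mul_sph_one hlam hD
  exact abs_greenSolI_le_mul_sph_one hlam hg hM hD0 hε hC hD ht

include hlam in
/-- **`G^I_λ` maps `W_1` into itself**: `G^I_λ g` is continuous on `(0, ∞)` with `|G^I_λ g| ≤ (D/(λ − 1)²) Ξ`. -/
theorem greenSolI_mem_weighted_one {g : ℝ → ℝ} (hg : ContinuousOn g (Ioi 0))
    {D : ℝ} (hD : ∀ s, 0 < s → |g s| ≤ D * sph 1 (hyp s)) :
    ContinuousOn (greenSolI (fun t => sph lam (hyp t)) (sphDecay lam) g) (Ioi 0) ∧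
      ∀ s, 0 < s → |greenSolI (fun t => sph lam (hyp t)) (sphDecay lam) g s| ≤ (D / (lam - 1) ^ 2) * sph 1 (hyp s) := by
  obtain ⟨hM, hD0, hε, C, hC⟩ := class_of_le_mul_sph_one hlam hD
  refine ⟨continuousOn_greenSolI hlam hg hM hD0 hε hC, fun s hs => ?_⟩
  rw [div_mul_eq_mul_div]
  exact abs_greenSolI_le_mul_sph_one' hlam hg hD hs

end measure

end Summit.Ventures.HodgeRepro2.T5SU11ResolventGroundStateWeight
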